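import Mathlib
import Literature.Analysis.FluidPDE.SuitableWeak
import Summits.NavierStokesRegularity.NavierStokesRegularity.Theorems.SelfMixingDichotomyCoherentScaleExclusionKinWitnessPointwise
import HarnessLib

-- single-conjunct summit (`<Problem> = <Summit>`): the duplicated namespace component is by design
set_option linter.dupNamespace false

/-!
# Route SelfMixingDichotomy — crux `CoherentScaleExclusion` (stmt-NavierStokesRegularity-1423),
# line `registered`, stub `stub_selfSimilarSwirl_loadCeiling` (SSW3)

Support file (`--supports stmt-NavierStokesRegularity-1423`) for the registered stub
`stub_selfSimilarSwirl_loadCeiling` of the lead's kinematic witness against the coherent Type-I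
exclusion: the exactly self-similar swirling eddy

`uA t x = (A (1 - t)⁻¹ expNegInvGlue (4 - ‖x‖² / (1 - t))) • J x` for `t < 1`, `uA t x = 0` for
`t ≥ 1`,

`J x = (-x₁, x₀, 0) = WithLp.toLp 2 ![-(x 1), x 0, 0]`, blow-up time `T = 1`, centre `0`,
amplitude `A ≥ 0`. This file proves the Type-I CEILING on its Caffarelli–Kohn–Nirenberg scaled
cubic load `C(r) = cknC r (1, 0) uA = r⁻² ∫∫_{Q_r(1,0)} |uA|³` (`Literature.Analysis.FluidPDE.cknC`,
backward parabolic cylinder `Q_r(1, 0) = (1 - r², 1) × B_r(0)`), uniformly in EVERY `r > 0`: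

`C(r) ≤ ofReal M₁`, `M₁ = (ofReal (64 A³) · |B₁|).toReal`.

Proof. Write `τ = 1 - t > 0` for a slice before the blow-up time. Pointwise,
`0 ≤ expNegInvGlue ≤ 1` and `‖J x‖ ≤ ‖x‖` (`kinWitness_pointwise_norm_rot_le`) give
`‖uA t x‖ ≤ A τ⁻¹ ‖x‖`; the glue factor vanishes once `‖x‖ ≥ 2√τ` (`‖x‖² / τ ≥ 4`), so
`‖uA t x‖ₑ³ ≤ 𝟙_{B(0, 2√τ)}(x) · ofReal ((A τ⁻¹ 2√τ)³)` and
`∫ ‖uA t ·‖ₑ³ ≤ ofReal ((A τ⁻¹ 2√τ)³ (2√τ)³) |B₁| = ofReal ((4A)³) |B₁|` (`|B_s| = s³ |B₁|` in `ℝ³`):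
the slice integral is INDEPENDENT of `t` (self-similarity). Tonelli's inequality
(`lintegral_prod_le`, no measurability needed) on `Q_r = (1 - r², 1) × B_r` then bounds
`∫∫_{Q_r} |uA|³ ≤ r² · ofReal (64 A³) |B₁|`, and the prefactor `(ofReal r ^ 2)⁻¹` cancels.
Slices with `t ≥ 1` do not meet `Q_r(1, 0)`.

Mathlib only (`lintegral_prod_le`, `setLIntegral_mono'`, `lintegral_indicator_const`,
`Measure.addHaar_ball_of_pos`, `finrank_euclideanSpace_fin`, `Real.volume_Ioo`) plus the tree lemma
`kinWitness_pointwise_norm_rot_le`; no named fact is taken as a hypothesis, no definition, no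
notation. The neighbouring stubs (`stub_selfSimilarSwirl_pointwise`, `stub_selfSimilarSwirl_loadFloor`,
…) are neither used nor restated.
-/

noncomputable section

open MeasureTheory Set Metric
open scoped ENNReal
open Literature.Analysis.FluidPDE

namespace Summit.NavierStokesRegularity.NavierStokesRegularity.Theorems

/-- Crude size of a slice of the self-similar swirl: for `A ≥ 0`, `τ > 0`,
`‖(A τ⁻¹ · expNegInvGlue (4 - ‖x‖²/τ)) • J x‖ ≤ A τ⁻¹ ‖x‖` (`0 ≤ glue ≤ 1`, `‖J x‖ ≤ ‖x‖`).
[folklore] -/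
theorem selfSimilarSwirl_loadCeiling_norm_slice_le {A τ : ℝ} (hA : 0 ≤ A) (hτ : 0 < τ)
    (x : EuclideanSpace ℝ (Fin 3)) :
    ‖(A * τ⁻¹ * expNegInvGlue (4 - ‖x‖ ^ 2 / τ)) •
        (WithLp.toLp 2 ![-(x 1), x 0, 0] : EuclideanSpace ℝ (Fin 3))‖ ≤ A * τ⁻¹ * ‖x‖ := by
  have hAτ : 0 ≤ A * τ⁻¹ := mul_nonneg hA (inv_nonneg.2 hτ.le)
  rw [norm_smul, Real.norm_eq_abs, abs_of_nonneg (mul_nonneg hAτ (expNegInvGlue.nonneg _))]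
  refine mul_le_mul ?_ (kinWitness_pointwise_norm_rot_le x) (norm_nonneg _) hAτ
  refine mul_le_of_le_one_right hAτ ?_
  -- `expNegInvGlue y ≤ 1`: it is `0` for `y ≤ 0` and `exp (-y⁻¹) ≤ exp 0 = 1` for `y > 0`.
  unfold expNegInvGlue
  split_ifs with h
  · exact zero_le_one
  · exact Real.exp_le_one_iff.mpr (neg_nonpos.mpr (inv_nonneg.mpr (le_of_lt (not_le.mp h))))

/-- Support of a slice of the self-similar swirl: for `τ > 0` and `2√τ ≤ ‖x‖` the slice
`(A τ⁻¹ · expNegInvGlue (4 - ‖x‖²/τ)) • J x` vanishes (`‖x‖² ≥ 4τ`, so the argument of the glue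
function is `≤ 0`). [folklore] -/
theorem selfSimilarSwirl_loadCeiling_slice_eq_zero (A : ℝ) {τ : ℝ} (hτ : 0 < τ)
    {x : EuclideanSpace ℝ (Fin 3)} (hx : 2 * Real.sqrt τ ≤ ‖x‖) :
    (A * τ⁻¹ * expNegInvGlue (4 - ‖x‖ ^ 2 / τ)) •
      (WithLp.toLp 2 ![-(x 1), x 0, 0] : EuclideanSpace ℝ (Fin 3)) = 0 := by
  have h2 : (2 * Real.sqrt τ) ^ 2 ≤ ‖x‖ ^ 2 := pow_le_pow_left₀ (by positivity) hx 2
  have h4 : 4 * τ ≤ ‖x‖ ^ 2 := by nlinarith [Real.sq_sqrt hτ.le, h2]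
  have harg : 4 - ‖x‖ ^ 2 / τ ≤ 0 := by
    rw [sub_nonpos, le_div_iff₀ hτ]
    exact h4
  rw [expNegInvGlue.zero_of_nonpos harg, mul_zero, zero_smul]

/-- Pointwise cubic bound of a slice of the self-similar swirl by an indicator: for `A ≥ 0`,
`τ > 0`, `‖slice τ x‖ₑ³ ≤ 𝟙_{B(0, 2√τ)}(x) · ofReal ((A τ⁻¹ (2√τ))³)` (inside the ball
`‖slice‖ ≤ A τ⁻¹ ‖x‖ < A τ⁻¹ 2√τ`; outside the slice is `0`). [folklore] -/
theorem selfSimilarSwirl_loadCeiling_enorm_cube_le {A τ : ℝ} (hA : 0 ≤ A) (hτ : 0 < τ)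
    (x : EuclideanSpace ℝ (Fin 3)) :
    ‖(A * τ⁻¹ * expNegInvGlue (4 - ‖x‖ ^ 2 / τ)) •
          (WithLp.toLp 2 ![-(x 1), x 0, 0] : EuclideanSpace ℝ (Fin 3))‖ₑ ^ (3 : ℕ) ≤
      (ball (0 : EuclideanSpace ℝ (Fin 3)) (2 * Real.sqrt τ)).indicator
        (fun _ => ENNReal.ofReal ((A * τ⁻¹ * (2 * Real.sqrt τ)) ^ 3)) x := by
  by_cases hx : x ∈ ball (0 : EuclideanSpace ℝ (Fin 3)) (2 * Real.sqrt τ)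
  · rw [indicator_of_mem hx, ← ofReal_norm, ← ENNReal.ofReal_pow (norm_nonneg _)]
    refine ENNReal.ofReal_le_ofReal (pow_le_pow_left₀ (norm_nonneg _) ?_ 3)
    refine (selfSimilarSwirl_loadCeiling_norm_slice_le hA hτ x).trans ?_
    rw [mem_ball_zero_iff] at hx
    exact mul_le_mul_of_nonneg_left hx.le (mul_nonneg hA (inv_nonneg.2 hτ.le))
  · rw [indicator_of_notMem hx]
    rw [mem_ball_zero_iff, not_lt] at hx
    rw [selfSimilarSwirl_loadCeiling_slice_eq_zero A hτ hx, enorm_zero, zero_pow three_ne_zero]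

/-- The real-number identity behind the self-similarity of the load:
`(A τ⁻¹ (2√τ))³ · (2√τ)³ = 64 A³` for `τ > 0` (`√τ · √τ = τ`). [folklore] -/
theorem selfSimilarSwirl_loadCeiling_const_eq {A τ : ℝ} (hτ : 0 < τ) :
    (A * τ⁻¹ * (2 * Real.sqrt τ)) ^ 3 * (2 * Real.sqrt τ) ^ 3 = 64 * A ^ 3 := by
  have h : A * τ⁻¹ * (2 * Real.sqrt τ) * (2 * Real.sqrt τ) = 4 * A := by
    calc A * τ⁻¹ * (2 * Real.sqrt τ) * (2 * Real.sqrt τ)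
        = 4 * A * (τ⁻¹ * (Real.sqrt τ * Real.sqrt τ)) := by ring
      _ = 4 * A := by rw [Real.mul_self_sqrt hτ.le, inv_mul_cancel₀ hτ.ne', mul_one]
  rw [← mul_pow, h]
  ring

/-- Slice integral of the self-similar swirl: for `A ≥ 0`, `τ > 0`,
`∫ ‖slice τ x‖ₑ³ dx ≤ ofReal (64 A³) · |B₁|`, INDEPENDENT of `τ`
(`∫ 𝟙_{B(0,2√τ)} c = c |B(0, 2√τ)| = c (2√τ)³ |B₁|` and `selfSimilarSwirl_loadCeiling_const_eq`).
[folklore] -/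
theorem selfSimilarSwirl_loadCeiling_lintegral_slice_le {A τ : ℝ} (hA : 0 ≤ A) (hτ : 0 < τ) :
    ∫⁻ x : EuclideanSpace ℝ (Fin 3), ‖(A * τ⁻¹ * expNegInvGlue (4 - ‖x‖ ^ 2 / τ)) •
          (WithLp.toLp 2 ![-(x 1), x 0, 0] : EuclideanSpace ℝ (Fin 3))‖ₑ ^ (3 : ℕ) ≤
      ENNReal.ofReal (64 * A ^ 3) * volume (ball (0 : EuclideanSpace ℝ (Fin 3)) 1) := by
  have hR : (0 : ℝ) < 2 * Real.sqrt τ := by positivity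
  have hK : (0 : ℝ) ≤ (A * τ⁻¹ * (2 * Real.sqrt τ)) ^ 3 :=
    pow_nonneg (mul_nonneg (mul_nonneg hA (inv_nonneg.2 hτ.le)) hR.le) 3
  refine (lintegral_mono fun x => selfSimilarSwirl_loadCeiling_enorm_cube_le hA hτ x).trans ?_
  rw [lintegral_indicator_const measurableSet_ball,
    Measure.addHaar_ball_of_pos volume (0 : EuclideanSpace ℝ (Fin 3)) hR,
    finrank_euclideanSpace_fin, ← mul_assoc, ← ENNReal.ofReal_mul hK,
    selfSimilarSwirl_loadCeiling_const_eq hτ]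

/-- **SSW3 — Type-I ceiling on the CKN load of the self-similar swirling eddy (registered stub
`stub_selfSimilarSwirl_loadCeiling` of the crux `CoherentScaleExclusion`, line `registered`).**
For every amplitude `A ≥ 0` there is `M₁` (namely `M₁ = (ofReal (64 A³) · |B₁|).toReal`) such that
for EVERY `r > 0` the scaled cubic load of
`uA t x = (A (1 - t)⁻¹ expNegInvGlue (4 - ‖x‖²/(1 - t))) • (-x₁, x₀, 0)` (`t < 1`; `0` for `t ≥ 1`)
on the backward parabolic cylinder `Q_r(1, 0)` satisfies `cknC r (1, 0) uA ≤ ofReal M₁`: every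
slice `t ∈ (1 - r², 1)` has `∫ ‖uA t ·‖ₑ³ ≤ ofReal (64 A³) |B₁|`
(`selfSimilarSwirl_loadCeiling_lintegral_slice_le`), Tonelli's inequality `lintegral_prod_le` gives
`∫∫_{Q_r} ‖uA‖ₑ³ ≤ ofReal r ^ 2 · ofReal (64 A³) |B₁|`, and `(ofReal r ^ 2)⁻¹` cancels. [folklore] -/
theorem stub_selfSimilarSwirl_loadCeiling :
    ∀ A : ℝ, 0 ≤ A → ∃ M₁ : ℝ, ∀ r : ℝ, 0 < r →
      cknC r (((1 : ℝ), (0 : EuclideanSpace ℝ (Fin 3))) : ℝ × EuclideanSpace ℝ (Fin 3))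
          (fun (t : ℝ) (x : EuclideanSpace ℝ (Fin 3)) => if t < 1 then
            (A * (1 - t)⁻¹ * expNegInvGlue (4 - ‖x‖ ^ 2 / (1 - t))) •
              (WithLp.toLp 2 ![-(x 1), x 0, 0] : EuclideanSpace ℝ (Fin 3)) else 0) ≤
        ENNReal.ofReal M₁ := by
  intro A hA
  -- the bound `B = ofReal (64 A³) · |B₁| < ∞` and `M₁ = B.toReal`
  set B : ℝ≥0∞ :=
    ENNReal.ofReal (64 * A ^ 3) * volume (ball (0 : EuclideanSpace ℝ (Fin 3)) 1) with hB
  have hBtop : B ≠ ⊤ := ENNReal.mul_ne_top ENNReal.ofReal_ne_top measure_ball_lt_top.ne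
  refine ⟨B.toReal, fun r hr => ?_⟩
  rw [ENNReal.ofReal_toReal hBtop]
  -- the centre `z = (1, 0)` and the field `u = uA`
  set z : ℝ × EuclideanSpace ℝ (Fin 3) := ((1 : ℝ), (0 : EuclideanSpace ℝ (Fin 3))) with hz
  set u : ℝ → EuclideanSpace ℝ (Fin 3) → EuclideanSpace ℝ (Fin 3) := fun t x =>
    if t < 1 then
      (A * (1 - t)⁻¹ * expNegInvGlue (4 - ‖x‖ ^ 2 / (1 - t))) •
        (WithLp.toLp 2 ![-(x 1), x 0, 0] : EuclideanSpace ℝ (Fin 3))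
    else 0 with hu
  -- slices before the blow-up time: `∫ ‖u t ·‖ₑ³ ≤ B`
  have hslice : ∀ t : ℝ, t < 1 → ∫⁻ x, ‖u t x‖ₑ ^ (3 : ℕ) ≤ B := by
    intro t ht
    have hτ : 0 < 1 - t := sub_pos.2 ht
    simp only [hu, if_pos ht]
    exact selfSimilarSwirl_loadCeiling_lintegral_slice_le hA hτ
  -- the space–time integral over `Q_r(1, 0) = (1 - r², 1) × B_r(0)` by Tonelli's inequality
  have hQ : parabolicCylinder r z =
      Ioo (1 - r ^ 2) 1 ×ˢ ball (0 : EuclideanSpace ℝ (Fin 3)) r := rfl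
  have hint : ∫⁻ q in parabolicCylinder r z, ‖u q.1 q.2‖ₑ ^ (3 : ℕ) ≤
      ENNReal.ofReal r ^ 2 * B := by
    rw [hQ, Measure.volume_eq_prod, ← Measure.prod_restrict]
    refine (lintegral_prod_le _).trans ?_
    calc ∫⁻ t in Ioo (1 - r ^ 2) 1, ∫⁻ x in ball (0 : EuclideanSpace ℝ (Fin 3)) r,
          ‖u (t, x).1 (t, x).2‖ₑ ^ (3 : ℕ)
        ≤ ∫⁻ _ in Ioo (1 - r ^ 2) 1, B := by
          refine setLIntegral_mono' measurableSet_Ioo fun t ht => ?_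
          exact (setLIntegral_le_lintegral _ _).trans (hslice t ht.2)
      _ = ENNReal.ofReal r ^ 2 * B := by
          rw [setLIntegral_const, Real.volume_Ioo, sub_sub_cancel, ENNReal.ofReal_pow hr.le,
            mul_comm]
  -- assemble: `cknC = (ofReal r ^ 2)⁻¹ · ∫∫ ≤ (ofReal r ^ 2)⁻¹ · (ofReal r ^ 2 · B) = B`
  have h0 : ENNReal.ofReal r ^ 2 ≠ 0 := pow_ne_zero _ (ENNReal.ofReal_pos.2 hr).ne'
  have htop : ENNReal.ofReal r ^ 2 ≠ ⊤ := ENNReal.pow_ne_top ENNReal.ofReal_ne_top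
  calc cknC r z u
      = (ENNReal.ofReal r ^ 2)⁻¹ * ∫⁻ q in parabolicCylinder r z, ‖u q.1 q.2‖ₑ ^ (3 : ℕ) :=
        rfl
    _ ≤ (ENNReal.ofReal r ^ 2)⁻¹ * (ENNReal.ofReal r ^ 2 * B) := mul_le_mul' le_rfl hint
    _ = B := by rw [← mul_assoc, ENNReal.inv_mul_cancel h0 htop, one_mul]

end Summit.NavierStokesRegularity.NavierStokesRegularity.Theorems
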